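import Mathlib
import HarnessLib
import Summits.ValiantsHypothesis.ValiantsHypothesis.Theorems.LacunarySymmetroidMatrixDescartesOsculationLawCuspNonMonicCount
import Summits.ValiantsHypothesis.ValiantsHypothesis.Theorems.LacunarySymmetroidMatrixDescartesOsculationLawRankOneColumn

/-!
# ValiantsHypothesis / LacunarySymmetroid — crux `MatrixDescartes` (stmt-ValiantsHypothesis-18050, V1),
# line `Cruxes/MatrixDescartes/Lines/osculation_law.lean` («osculation-law»): the `(2,1)` SPLITTING of the `m = 3` rung

For the block splitting `(r, s) = (2, 1)` of `OsculationLawAt 3 K ·` — a RANK-TWO semidefinite letter `b·(I₂ ⊕ 0)`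
inserted into a symmetric `3 × 3` pencil `G = Σ_l t^(d l) S_l` — the insertion polynomial is the NON-MONIC quadratic
`Φ(t,b) = det(G + b(I₂ ⊕ 0)) = a·b² + m·b + δ`, `a = G₂₂` (the `(inr 0, inr 0)` entry), `m = G₀₀G₂₂ − G₀₂G₂₀ +
G₁₁G₂₂ − G₁₂G₂₁`, `δ = det G` (`insertionPoly_two_one`, via `det_two_one`).  Symmetry makes `Φ(t,·)` real-rooted:
`m² − 4aδ = (G₀₀G₂₂ − G₀₂² − G₁₁G₂₂ + G₁₂²)² + 4(G₀₁G₂₂ − G₀₂G₁₂)²` (`disc_two_one`).  The exponents of `a, m, δ` lie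
in `E, 2•E, 3•E` (`E = image d`), so the pseudo-remainder pair `U, V` of `OsculationCuspGen.hess_reduce_poly` (p605555;
isobaric of weights `12`, `13`) and `N = aV² − mUV + δU²` (weight `27`) are supported in `12•E`, `13•E`, `27•E`
(`supp_U`, `supp_V`, `supp_N`; monomial bookkeeping generated mechanically from the tree's own `U`, `V` texts and checked
by the kernel), and the count `OsculationCuspGen.nonmonic_cusp_ncard_le` gives, for `a ≢ 0`,
`#osc ≤ K²⁷ + 2K¹² + 2K¹³`; for `a ≡ 0` the letter is rank-one-shaped, `Φ = ι δ + X₁·ι m`, and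
`OsculationRankOne.osc_ncard_le` with `supp(W(δ)m² − W(m)δ²) ⊆ 10•E` gives `≤ K¹⁰`.  Hence

  `osc_two_one (K d S) : … (osculation set finite) → #osc ≤ 5 · K ^ 27`

with the line's vocabulary UNFOLDED verbatim (same shape as `OsculationTwoK.osc_two_zero`), ready for the `r = 2`
branch of an `osculationLawAt_three`.  Honest framing: a located PIECE (one splitting of one rung) of an UNREGISTERED
V1 law line with a Descartes ceiling (`K²⁷`, nowhere near the instrument's conjectured linear face); the `(3,0)`
splitting, `OsculationLaw` (all `m`), `PeelInequality`, `stub_recursion`, `MatrixDescartes`, Conjecture B and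
`VP ≠ VNP` are OPEN / NOT proved and nothing here is progress on them.  No definitions, no named facts; Mathlib + tree
osculation files only.
-/

-- `Summit.ValiantsHypothesis.ValiantsHypothesis.…` is the tree's mandated single-conjunct layout (Sub = Summit).
set_option linter.dupNamespace false

noncomputable section

namespace Summit.ValiantsHypothesis.ValiantsHypothesis.Theorems.LacunarySymmetroidMatrixDescartes

open Polynomial Set
open scoped BigOperators Pointwise

namespace OsculationThreeK

open OsculationCusp OsculationTwoK

/-! ### The `3 × 3` determinant on `Fin 2 ⊕ Fin 1` and the insertion polynomial -/

/-- A `3 × 3` determinant on `Fin 2 ⊕ Fin 1` (Sarrus; indices `inl 0, inl 1, inr 0`). [folklore] -/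
theorem det_two_one {R : Type*} [CommRing R] (N : Matrix (Fin 2 ⊕ Fin 1) (Fin 2 ⊕ Fin 1) R) :
    N.det = N (Sum.inl 0) (Sum.inl 0) * N (Sum.inl 1) (Sum.inl 1) * N (Sum.inr 0) (Sum.inr 0)
      - N (Sum.inl 0) (Sum.inl 0) * N (Sum.inl 1) (Sum.inr 0) * N (Sum.inr 0) (Sum.inl 1)
      - N (Sum.inl 0) (Sum.inl 1) * N (Sum.inl 1) (Sum.inl 0) * N (Sum.inr 0) (Sum.inr 0)
      + N (Sum.inl 0) (Sum.inl 1) * N (Sum.inl 1) (Sum.inr 0) * N (Sum.inr 0) (Sum.inl 0)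
      + N (Sum.inl 0) (Sum.inr 0) * N (Sum.inl 1) (Sum.inl 0) * N (Sum.inr 0) (Sum.inl 1)
      - N (Sum.inl 0) (Sum.inr 0) * N (Sum.inl 1) (Sum.inl 1) * N (Sum.inr 0) (Sum.inl 0) := by
  rw [← Matrix.det_reindex_self (finSumFinEquiv (m := 2) (n := 1)) N, Matrix.det_fin_three]
  have h0 : (finSumFinEquiv (m := 2) (n := 1)).symm 0 = Sum.inl 0 := by decide
  have h1 : (finSumFinEquiv (m := 2) (n := 1)).symm 1 = Sum.inl 1 := by decide
  have h2 : (finSumFinEquiv (m := 2) (n := 1)).symm 2 = Sum.inr 0 := by decide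
  simp only [Matrix.reindex_apply, Matrix.submatrix_apply, h0, h1, h2]

/-- At `(2,1)` the insertion polynomial is `X₁X₁·ι(G₂₂) + X₁·ι(G₀₀G₂₂ − G₀₂G₂₀ + G₁₁G₂₂ − G₁₂G₂₁) + ι(det G)`.
[folklore] -/
theorem insertionPoly_two_one (K : ℕ) (d : Fin K → ℕ) (S : Fin K → Matrix (Fin 2 ⊕ Fin 1) (Fin 2 ⊕ Fin 1) ℝ) :
    (∑ l, (MvPolynomial.X (0 : Fin 2) : MvPolynomial (Fin 2) ℝ) ^ d l •
              (S l).map (MvPolynomial.C : ℝ →+* MvPolynomial (Fin 2) ℝ)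
            + (MvPolynomial.X (1 : Fin 2) : MvPolynomial (Fin 2) ℝ) •
              (Matrix.fromBlocks 1 0 0 0 : Matrix (Fin 2 ⊕ Fin 1) (Fin 2 ⊕ Fin 1) ℝ).map
                (MvPolynomial.C : ℝ →+* MvPolynomial (Fin 2) ℝ)).det =
      MvPolynomial.X 1 * MvPolynomial.X 1 * Polynomial.aeval (MvPolynomial.X 0 : MvPolynomial (Fin 2) ℝ) ((∑ l, (X : ℝ[X]) ^ d l • (S l).map Polynomial.C) (Sum.inr 0) (Sum.inr 0))
        + MvPolynomial.X 1 * Polynomial.aeval (MvPolynomial.X 0 : MvPolynomial (Fin 2) ℝ) ((∑ l, (X : ℝ[X]) ^ d l • (S l).map Polynomial.C) (Sum.inl 0) (Sum.inl 0) * (∑ l, (X : ℝ[X]) ^ d l • (S l).map Polynomial.C) (Sum.inr 0) (Sum.inr 0) - (∑ l, (X : ℝ[X]) ^ d l • (S l).map Polynomial.C) (Sum.inl 0) (Sum.inr 0) * (∑ l, (X : ℝ[X]) ^ d l • (S l).map Polynomial.C) (Sum.inr 0) (Sum.inl 0) + (∑ l, (X : ℝ[X]) ^ d l • (S l).map Polynomial.C)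 (Sum.inl 1) (Sum.inl 1) * (∑ l, (X : ℝ[X]) ^ d l • (S l).map Polynomial.C) (Sum.inr 0) (Sum.inr 0) - (∑ l, (X : ℝ[X]) ^ d l • (S l).map Polynomial.C) (Sum.inl 1) (Sum.inr 0) * (∑ l, (X : ℝ[X]) ^ d l • (S l).map Polynomial.C) (Sum.inr 0) (Sum.inl 1))
        + Polynomial.aeval (MvPolynomial.X 0 : MvPolynomial (Fin 2) ℝ) (∑ l, (X : ℝ[X]) ^ d l • (S l).map Polynomial.C).det := by
  rw [AlgHom.map_det, AlgHom.mapMatrix_apply, det_two_one, det_two_one, ← map_aevalX0_pencil_gen d S]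
  simp only [Matrix.add_apply, Matrix.smul_apply, Matrix.map_apply, Matrix.fromBlocks_apply₁₁,
    Matrix.fromBlocks_apply₁₂, Matrix.fromBlocks_apply₂₁, Matrix.fromBlocks_apply₂₂, Matrix.one_apply_eq,
    Matrix.one_apply_ne (show (0 : Fin 2) ≠ 1 by decide), Matrix.one_apply_ne (show (1 : Fin 2) ≠ 0 by decide),
    Matrix.zero_apply, smul_eq_mul, map_zero, map_one, mul_one, mul_zero, add_zero, map_add, map_sub, map_mul]
  ring

/-- Symmetric `3 × 3` pencils give a real-rooted letter: `4·a(t)·δ(t) ≤ m(t)²`, by the sum of squares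
`m² − 4aδ = (G₀₀G₂₂ − G₀₂² − G₁₁G₂₂ + G₁₂²)² + 4(G₀₁G₂₂ − G₀₂G₁₂)²`. [folklore] -/
theorem disc_two_one (K : ℕ) (d : Fin K → ℕ) (S : Fin K → Matrix (Fin 2 ⊕ Fin 1) (Fin 2 ⊕ Fin 1) ℝ)
    (hS : ∀ l, (S l).IsSymm) (t : ℝ) :
    4 * (((∑ l, (X : ℝ[X]) ^ d l • (S l).map Polynomial.C) (Sum.inr 0) (Sum.inr 0)).eval t * ((∑ l, (X : ℝ[X]) ^ d l • (S l).map Polynomial.C).det).eval t) ≤ (((∑ l, (X : ℝ[X]) ^ d l • (S l).map Polynomial.C) (Sum.inl 0) (Sum.inl 0) * (∑ l, (X : ℝ[X]) ^ d l • (S l).map Polynomial.C) (Sum.inr 0) (Sum.inr 0) - (∑ l, (X : ℝ[X]) ^ d l • (S l).map Polynomial.C) (Sum.inl 0) (Sum.inr 0) * (∑ l, (X : ℝ[X]) ^ d l • (S l).map Polynomial.C) (Sum.inr 0) (Sum.inl 0) + (∑ l, (X : ℝ[X]) ^ d l • (S l).map Polynomial.C) (Sum.inl 1) (Sum.inl 1)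 * (∑ l, (X : ℝ[X]) ^ d l • (S l).map Polynomial.C) (Sum.inr 0) (Sum.inr 0) - (∑ l, (X : ℝ[X]) ^ d l • (S l).map Polynomial.C) (Sum.inl 1) (Sum.inr 0) * (∑ l, (X : ℝ[X]) ^ d l • (S l).map Polynomial.C) (Sum.inr 0) (Sum.inl 1))).eval t ^ 2 := by
  have hsym : ∀ i j, ((∑ l, (X : ℝ[X]) ^ d l • (S l).map Polynomial.C) i j).eval t = ((∑ l, (X : ℝ[X]) ^ d l • (S l).map Polynomial.C) j i).eval t := by
    intro i j
    rw [pencil_apply, pencil_apply]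
    congr 1
    refine Finset.sum_congr rfl fun l _ => ?_
    rw [(hS l).apply i j]
  have hdet : ((∑ l, (X : ℝ[X]) ^ d l • (S l).map Polynomial.C).det).eval t = ((∑ l, (X : ℝ[X]) ^ d l • (S l).map Polynomial.C).map (Polynomial.eval t)).det := by
    rw [← Polynomial.coe_evalRingHom, RingHom.map_det, RingHom.mapMatrix_apply]
  rw [hdet, det_two_one]
  simp only [Matrix.map_apply, eval_add, eval_sub, eval_mul]
  rw [hsym (Sum.inr 0) (Sum.inl 0), hsym (Sum.inr 0) (Sum.inl 1), hsym (Sum.inl 1) (Sum.inl 0)]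
  nlinarith [sq_nonneg (((∑ l, (X : ℝ[X]) ^ d l • (S l).map Polynomial.C) (Sum.inl 0) (Sum.inl 0)).eval t * ((∑ l, (X : ℝ[X]) ^ d l • (S l).map Polynomial.C) (Sum.inr 0) (Sum.inr 0)).eval t - ((∑ l, (X : ℝ[X]) ^ d l • (S l).map Polynomial.C) (Sum.inl 0) (Sum.inr 0)).eval t ^ 2
      - ((∑ l, (X : ℝ[X]) ^ d l • (S l).map Polynomial.C) (Sum.inl 1) (Sum.inl 1)).eval t * ((∑ l, (X : ℝ[X]) ^ d l • (S l).map Polynomial.C) (Sum.inr 0) (Sum.inr 0)).eval t + ((∑ l, (X : ℝ[X]) ^ d l • (S l).map Polynomial.C) (Sum.inl 1) (Sum.inr 0)).eval t ^ 2),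
    sq_nonneg (((∑ l, (X : ℝ[X]) ^ d l • (S l).map Polynomial.C) (Sum.inl 0) (Sum.inl 1)).eval t * ((∑ l, (X : ℝ[X]) ^ d l • (S l).map Polynomial.C) (Sum.inr 0) (Sum.inr 0)).eval t - ((∑ l, (X : ℝ[X]) ^ d l • (S l).map Polynomial.C) (Sum.inl 0) (Sum.inr 0)).eval t * ((∑ l, (X : ℝ[X]) ^ d l • (S l).map Polynomial.C) (Sum.inl 1) (Sum.inr 0)).eval t)]

/-! ### Monomial counts: `a ⊆ E`, `m ⊆ 2•E`, `δ ⊆ 3•E`, `U ⊆ 12•E`, `V ⊆ 13•E`, `N ⊆ 27•E` -/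

/-- `supp m ⊆ 2 • E`. [folklore] -/
theorem supp_m (K : ℕ) (d : Fin K → ℕ) (S : Fin K → Matrix (Fin 2 ⊕ Fin 1) (Fin 2 ⊕ Fin 1) ℝ) :
    ((∑ l, (X : ℝ[X]) ^ d l • (S l).map Polynomial.C) (Sum.inl 0) (Sum.inl 0) * (∑ l, (X : ℝ[X]) ^ d l • (S l).map Polynomial.C) (Sum.inr 0) (Sum.inr 0) - (∑ l, (X : ℝ[X]) ^ d l • (S l).map Polynomial.C) (Sum.inl 0) (Sum.inr 0) * (∑ l, (X : ℝ[X]) ^ d l • (S l).map Polynomial.C) (Sum.inr 0) (Sum.inl 0) + (∑ l, (X : ℝ[X]) ^ d l • (S l).map Polynomial.C) (Sum.inl 1) (Sum.inl 1) * (∑ l, (X : ℝ[X]) ^ d l • (S l).map Polynomial.C) (Sum.inr 0) (Sum.inr 0) - (∑ l, (X : ℝ[X]) ^ d l • (S l).map Polynomial.C) (Sum.inl 1) (Sum.inr 0) * (∑ l, (X : ℝ[X]) ^ d l • (S l).map Polynomial.C) (Sum.inr 0) (Sum.inl 1)).support ⊆ 2 • Finset.univ.image d := by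
  have h := support_pencil_apply d S
  exact supp_sub (supp_add (supp_sub (supp_cast (supp_mul (h _ _) (h _ _)) (by norm_num))
    (supp_cast (supp_mul (h _ _) (h _ _)) (by norm_num))) (supp_cast (supp_mul (h _ _) (h _ _)) (by norm_num)))
    (supp_cast (supp_mul (h _ _) (h _ _)) (by norm_num))

/-- `supp U ⊆ 12 • E` for the `b`-coefficient `U` of the pseudo-remainder (`OsculationCuspGen.eval_U`; every monomial
has weight `12` for `wt(a, m, δ) = (1, 2, 3)`, `θ` weightless). [folklore] -/
theorem supp_U (a m δ : ℝ[X]) (E : Finset ℕ) (ha : a.support ⊆ 1 • E) (hm : m.support ⊆ 2 • E)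
    (hδ : δ.support ⊆ 3 • E) :
    ((4 : ℝ[X]) * a ^ 4 * m * δ * (X * derivative (X * derivative δ)) - (3 : ℝ[X]) * a ^ 4 * m * (X * derivative δ) ^ 2 + (4 : ℝ[X]) * a ^ 4 * δ ^ 2 * (X * derivative (X * derivative m)) - (4 : ℝ[X]) * a ^ 4 * δ * (X * derivative m) * (X * derivative δ) - a ^ 3 * m ^ 3 * (X * derivative (X * derivative δ)) - (5 : ℝ[X]) * a ^ 3 * m ^ 2 * δ * (X * derivative (X * derivative m)) + (4 : ℝ[X]) * a ^ 3 * m ^ 2 * (X * derivative m) * (X * derivative δ) - (8 : ℝ[X]) * a ^ 3 * m * δ ^ 2 * (X * derivative (X * derivative a)) + (2 : ℝ[X]) * a ^ 3 * m * δ * (X * derivative a) * (X * derivative δ) + a ^ 3 * m * δ * (X * derivative m) ^ 2 - (4 : ℝ[X]) * a ^ 3 * δ ^ 2 * (X * derivative a) * (X * derivative m) + a ^ 2 * m ^ 4 * (X * derivative (X * derivative m)) + (6 : ℝ[X]) * a ^ 2 * m ^ 3 * δ * (X * derivative (X * derivative a)) - (2 : ℝ[X]) * a ^ 2 * m ^ 3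 * (X * derivative a) * (X * derivative δ) - a ^ 2 * m ^ 3 * (X * derivative m) ^ 2 + (4 : ℝ[X]) * a ^ 2 * m ^ 2 * δ * (X * derivative a) * (X * derivative m) + (9 : ℝ[X]) * a ^ 2 * m * δ ^ 2 * (X * derivative a) ^ 2 - a * m ^ 5 * (X * derivative (X * derivative a)) - (7 : ℝ[X]) * a * m ^ 3 * δ * (X * derivative a) ^ 2 + m ^ 5 * (X * derivative a) ^ 2).support ⊆ 12 • E := by
  exact supp_add (supp_sub (supp_sub (supp_add (supp_add (supp_sub (supp_sub (supp_add (supp_add (supp_sub (supp_add (supp_add (supp_sub (supp_add (supp_sub (supp_sub (supp_sub (supp_add (supp_sub (supp_cast (supp_mul (supp_mul (supp_mul (supp_ofNat_mul 4 (supp_pow ha 4 (by norm_num))) (hm)) (hδ)) (supp_theta (supp_theta hδ))) (by norm_num)) (supp_cast (supp_mul (supp_mul (supp_ofNat_mul 3 (supp_pow ha 4 (by norm_num))) (hm)) (supp_pow (supp_theta hδ) 2 (by norm_num))) (by norm_num))) (supp_cast (supp_mul (supp_mul (supp_ofNat_mul 4 (supp_pow ha 4 (by norm_num))) (supp_pow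 hδ 2 (by norm_num))) (supp_theta (supp_theta hm))) (by norm_num))) (supp_cast (supp_mul (supp_mul (supp_mul (supp_ofNat_mul 4 (supp_pow ha 4 (by norm_num))) (hδ)) (supp_theta hm)) (supp_theta hδ)) (by norm_num))) (supp_cast (supp_mul (supp_mul (supp_pow ha 3 (by norm_num)) (supp_pow hm 3 (by norm_num))) (supp_theta (supp_theta hδ))) (by norm_num))) (supp_cast (supp_mul (supp_mul (supp_mul (supp_ofNat_mul 5 (supp_pow ha 3 (by norm_num))) (supp_pow hm 2 (by norm_num))) (hδ)) (supp_theta (supp_theta hm))) (by norm_num))) (supp_cast (supp_mul (supp_mul (supp_mul (supp_ofNat_mul 4 (supp_pow ha 3 (by norm_num))) (supp_pow hm 2 (by norm_num))) (supp_theta hm)) (supp_theta hδ)) (by norm_num))) (supp_cast (supp_mul (supp_mul (supp_mul (supp_ofNat_mul 8 (supp_pow ha 3 (by norm_num))) (hm)) (supp_pow hδ 2 (by norm_num))) (supp_theta (supp_theta ha))) (by norm_num))) (supp_cast (supp_mul (supp_mul (supp_mul (supp_mul (supp_ofNat_mul 2 (supp_pow ha 3 (by norm_num))) (hm)) (hδ))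 (supp_theta ha)) (supp_theta hδ)) (by norm_num))) (supp_cast (supp_mul (supp_mul (supp_mul (supp_pow ha 3 (by norm_num)) (hm)) (hδ)) (supp_pow (supp_theta hm) 2 (by norm_num))) (by norm_num))) (supp_cast (supp_mul (supp_mul (supp_mul (supp_ofNat_mul 4 (supp_pow ha 3 (by norm_num))) (supp_pow hδ 2 (by norm_num))) (supp_theta ha)) (supp_theta hm)) (by norm_num))) (supp_cast (supp_mul (supp_mul (supp_pow ha 2 (by norm_num)) (supp_pow hm 4 (by norm_num))) (supp_theta (supp_theta hm))) (by norm_num))) (supp_cast (supp_mul (supp_mul (supp_mul (supp_ofNat_mul 6 (supp_pow ha 2 (by norm_num))) (supp_pow hm 3 (by norm_num))) (hδ)) (supp_theta (supp_theta ha))) (by norm_num))) (supp_cast (supp_mul (supp_mul (supp_mul (supp_ofNat_mul 2 (supp_pow ha 2 (by norm_num))) (supp_pow hm 3 (by norm_num))) (supp_theta ha)) (supp_theta hδ)) (by norm_num))) (supp_cast (supp_mul (supp_mul (supp_pow ha 2 (by norm_num)) (supp_pow hm 3 (by norm_num))) (supp_pow (supp_theta hm) 2 (by norm_num))) (by norm_num)))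 (supp_cast (supp_mul (supp_mul (supp_mul (supp_mul (supp_ofNat_mul 4 (supp_pow ha 2 (by norm_num))) (supp_pow hm 2 (by norm_num))) (hδ)) (supp_theta ha)) (supp_theta hm)) (by norm_num))) (supp_cast (supp_mul (supp_mul (supp_mul (supp_ofNat_mul 9 (supp_pow ha 2 (by norm_num))) (hm)) (supp_pow hδ 2 (by norm_num))) (supp_pow (supp_theta ha) 2 (by norm_num))) (by norm_num))) (supp_cast (supp_mul (supp_mul (ha) (supp_pow hm 5 (by norm_num))) (supp_theta (supp_theta ha))) (by norm_num))) (supp_cast (supp_mul (supp_mul (supp_mul (supp_ofNat_mul 7 (ha)) (supp_pow hm 3 (by norm_num))) (hδ)) (supp_pow (supp_theta ha) 2 (by norm_num))) (by norm_num))) (supp_cast (supp_mul (supp_pow hm 5 (by norm_num)) (supp_pow (supp_theta ha) 2 (by norm_num))) (by norm_num))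

/-- `supp V ⊆ 13 • E` for the constant coefficient `V` of the pseudo-remainder (weight `13`). [folklore] -/
theorem supp_V (a m δ : ℝ[X]) (E : Finset ℕ) (ha : a.support ⊆ 1 • E) (hm : m.support ⊆ 2 • E)
    (hδ : δ.support ⊆ 3 • E) :
    ((4 : ℝ[X]) * a ^ 4 * δ ^ 2 * (X * derivative (X * derivative δ)) - (4 : ℝ[X]) * a ^ 4 * δ * (X * derivative δ) ^ 2 - a ^ 3 * m ^ 2 * δ * (X * derivative (X * derivative δ)) - (4 : ℝ[X]) * a ^ 3 * m * δ ^ 2 * (X * derivative (X * derivative m)) + (4 : ℝ[X]) * a ^ 3 * m * δ * (X * derivative m) * (X * derivative δ) - (4 : ℝ[X]) * a ^ 3 * δ ^ 3 * (X * derivative (X * derivative a)) + a ^ 2 * m ^ 3 * δ * (X * derivative (X * derivative m)) + (5 : ℝ[X]) * a ^ 2 * m ^ 2 * δ ^ 2 * (X * derivative (X * derivative a)) - (2 : ℝ[X]) * a ^ 2 * m ^ 2 * δ * (X * derivative a) * (X * derivative δ) - a ^ 2 * m ^ 2 * δ * (X * derivative m) ^ 2 + (4 : ℝ[X]) * a ^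 2 * m * δ ^ 2 * (X * derivative a) * (X * derivative m) + (4 : ℝ[X]) * a ^ 2 * δ ^ 3 * (X * derivative a) ^ 2 - a * m ^ 4 * δ * (X * derivative (X * derivative a)) - (6 : ℝ[X]) * a * m ^ 2 * δ ^ 2 * (X * derivative a) ^ 2 + m ^ 4 * δ * (X * derivative a) ^ 2).support ⊆ 13 • E := by
  exact supp_add (supp_sub (supp_sub (supp_add (supp_add (supp_sub (supp_sub (supp_add (supp_add (supp_sub (supp_add (supp_sub (supp_sub (supp_sub (supp_cast (supp_mul (supp_mul (supp_ofNat_mul 4 (supp_pow ha 4 (by norm_num))) (supp_pow hδ 2 (by norm_num))) (supp_theta (supp_theta hδ))) (by norm_num)) (supp_cast (supp_mul (supp_mul (supp_ofNat_mul 4 (supp_pow ha 4 (by norm_num))) (hδ)) (supp_pow (supp_theta hδ) 2 (by norm_num))) (by norm_num))) (supp_cast (supp_mul (supp_mul (supp_mul (supp_pow ha 3 (by norm_num)) (supp_pow hm 2 (by norm_num))) (hδ)) (supp_theta (supp_theta hδ))) (by norm_num))) (supp_cast (supp_mul (supp_mul (supp_mul (supp_ofNat_mul 4 (supp_pow ha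 3 (by norm_num))) (hm)) (supp_pow hδ 2 (by norm_num))) (supp_theta (supp_theta hm))) (by norm_num))) (supp_cast (supp_mul (supp_mul (supp_mul (supp_mul (supp_ofNat_mul 4 (supp_pow ha 3 (by norm_num))) (hm)) (hδ)) (supp_theta hm)) (supp_theta hδ)) (by norm_num))) (supp_cast (supp_mul (supp_mul (supp_ofNat_mul 4 (supp_pow ha 3 (by norm_num))) (supp_pow hδ 3 (by norm_num))) (supp_theta (supp_theta ha))) (by norm_num))) (supp_cast (supp_mul (supp_mul (supp_mul (supp_pow ha 2 (by norm_num)) (supp_pow hm 3 (by norm_num))) (hδ)) (supp_theta (supp_theta hm))) (by norm_num))) (supp_cast (supp_mul (supp_mul (supp_mul (supp_ofNat_mul 5 (supp_pow ha 2 (by norm_num))) (supp_pow hm 2 (by norm_num))) (supp_pow hδ 2 (by norm_num))) (supp_theta (supp_theta ha))) (by norm_num))) (supp_cast (supp_mul (supp_mul (supp_mul (supp_mul (supp_ofNat_mul 2 (supp_pow ha 2 (by norm_num))) (supp_pow hm 2 (by norm_num))) (hδ)) (supp_theta ha)) (supp_theta hδ)) (by norm_num))) (supp_cast (supp_mul (supp_mul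 (supp_mul (supp_pow ha 2 (by norm_num)) (supp_pow hm 2 (by norm_num))) (hδ)) (supp_pow (supp_theta hm) 2 (by norm_num))) (by norm_num))) (supp_cast (supp_mul (supp_mul (supp_mul (supp_mul (supp_ofNat_mul 4 (supp_pow ha 2 (by norm_num))) (hm)) (supp_pow hδ 2 (by norm_num))) (supp_theta ha)) (supp_theta hm)) (by norm_num))) (supp_cast (supp_mul (supp_mul (supp_ofNat_mul 4 (supp_pow ha 2 (by norm_num))) (supp_pow hδ 3 (by norm_num))) (supp_pow (supp_theta ha) 2 (by norm_num))) (by norm_num))) (supp_cast (supp_mul (supp_mul (supp_mul (ha) (supp_pow hm 4 (by norm_num))) (hδ)) (supp_theta (supp_theta ha))) (by norm_num))) (supp_cast (supp_mul (supp_mul (supp_mul (supp_ofNat_mul 6 (ha)) (supp_pow hm 2 (by norm_num))) (supp_pow hδ 2 (by norm_num))) (supp_pow (supp_theta ha) 2 (by norm_num))) (by norm_num))) (supp_cast (supp_mul (supp_mul (supp_pow hm 4 (by norm_num)) (hδ)) (supp_pow (supp_theta ha) 2 (by norm_num))) (by norm_num))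

-- the statement carries `U` (twice) and `V` (twice): elaboration alone is slow.
set_option maxHeartbeats 1600000 in
/-- `supp N ⊆ 27 • E` for `N = a·V² − m·U·V + δ·U²` (weight `27`). [folklore] -/
theorem supp_N (a m δ : ℝ[X]) (E : Finset ℕ) (ha : a.support ⊆ 1 • E) (hm : m.support ⊆ 2 • E)
    (hδ : δ.support ⊆ 3 • E) :
    (a * ((4 : ℝ[X]) * a ^ 4 * δ ^ 2 * (X * derivative (X * derivative δ)) - (4 : ℝ[X]) * a ^ 4 * δ * (X * derivative δ) ^ 2 - a ^ 3 * m ^ 2 * δ * (X * derivative (X * derivative δ)) - (4 : ℝ[X]) * a ^ 3 * m * δ ^ 2 * (X * derivative (X * derivative m)) + (4 : ℝ[X]) * a ^ 3 * m * δ * (X * derivative m) * (X * derivative δ) - (4 : ℝ[X]) * a ^ 3 * δ ^ 3 * (X * derivative (X * derivative a)) + a ^ 2 * m ^ 3 * δ * (X * derivative (X * derivative m)) + (5 : ℝ[X]) * a ^ 2 * m ^ 2 * δ ^ 2 * (X * derivative (X * derivative a)) - (2 : ℝ[X]) * a ^ 2 * m ^ 2 * δ * (X * derivative a) * (X * derivative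 δ) - a ^ 2 * m ^ 2 * δ * (X * derivative m) ^ 2 + (4 : ℝ[X]) * a ^ 2 * m * δ ^ 2 * (X * derivative a) * (X * derivative m) + (4 : ℝ[X]) * a ^ 2 * δ ^ 3 * (X * derivative a) ^ 2 - a * m ^ 4 * δ * (X * derivative (X * derivative a)) - (6 : ℝ[X]) * a * m ^ 2 * δ ^ 2 * (X * derivative a) ^ 2 + m ^ 4 * δ * (X * derivative a) ^ 2) ^ 2 - m * ((4 : ℝ[X]) * a ^ 4 * m * δ * (X * derivative (X * derivative δ)) - (3 : ℝ[X]) * a ^ 4 * m * (X * derivative δ) ^ 2 + (4 : ℝ[X]) * a ^ 4 * δ ^ 2 * (X * derivative (X * derivative m)) - (4 : ℝ[X]) * a ^ 4 * δ * (X * derivative m) * (X * derivative δ) - a ^ 3 * m ^ 3 * (X * derivative (X * derivative δ)) - (5 : ℝ[X]) * a ^ 3 * m ^ 2 * δ * (X * derivative (X * derivative m)) + (4 : ℝ[X]) * a ^ 3 * m ^ 2 * (X * derivative m) * (X * derivative δ) - (8 : ℝ[X]) * a ^ 3 * m * δ ^ 2 * (X * derivative (X * derivative a)) + (2 : ℝ[X])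 * a ^ 3 * m * δ * (X * derivative a) * (X * derivative δ) + a ^ 3 * m * δ * (X * derivative m) ^ 2 - (4 : ℝ[X]) * a ^ 3 * δ ^ 2 * (X * derivative a) * (X * derivative m) + a ^ 2 * m ^ 4 * (X * derivative (X * derivative m)) + (6 : ℝ[X]) * a ^ 2 * m ^ 3 * δ * (X * derivative (X * derivative a)) - (2 : ℝ[X]) * a ^ 2 * m ^ 3 * (X * derivative a) * (X * derivative δ) - a ^ 2 * m ^ 3 * (X * derivative m) ^ 2 + (4 : ℝ[X]) * a ^ 2 * m ^ 2 * δ * (X * derivative a) * (X * derivative m) + (9 : ℝ[X]) * a ^ 2 * m * δ ^ 2 * (X * derivative a) ^ 2 - a * m ^ 5 * (X * derivative (X * derivative a)) - (7 : ℝ[X]) * a * m ^ 3 * δ * (X * derivative a) ^ 2 + m ^ 5 * (X * derivative a) ^ 2) * ((4 : ℝ[X]) * a ^ 4 * δ ^ 2 * (X * derivative (X * derivative δ)) - (4 : ℝ[X]) * a ^ 4 * δ * (X * derivative δ) ^ 2 - a ^ 3 * m ^ 2 * δ * (X * derivative (X * derivative δ)) - (4 : ℝ[X]) * a ^ 3 *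 m * δ ^ 2 * (X * derivative (X * derivative m)) + (4 : ℝ[X]) * a ^ 3 * m * δ * (X * derivative m) * (X * derivative δ) - (4 : ℝ[X]) * a ^ 3 * δ ^ 3 * (X * derivative (X * derivative a)) + a ^ 2 * m ^ 3 * δ * (X * derivative (X * derivative m)) + (5 : ℝ[X]) * a ^ 2 * m ^ 2 * δ ^ 2 * (X * derivative (X * derivative a)) - (2 : ℝ[X]) * a ^ 2 * m ^ 2 * δ * (X * derivative a) * (X * derivative δ) - a ^ 2 * m ^ 2 * δ * (X * derivative m) ^ 2 + (4 : ℝ[X]) * a ^ 2 * m * δ ^ 2 * (X * derivative a) * (X * derivative m) + (4 : ℝ[X]) * a ^ 2 * δ ^ 3 * (X * derivative a) ^ 2 - a * m ^ 4 * δ * (X * derivative (X * derivative a)) - (6 : ℝ[X]) * a * m ^ 2 * δ ^ 2 * (X * derivative a) ^ 2 + m ^ 4 * δ * (X * derivative a) ^ 2) + δ * ((4 : ℝ[X]) * a ^ 4 * m * δ * (X * derivative (X * derivative δ)) - (3 : ℝ[X]) * a ^ 4 * m * (X * derivative δ) ^ 2 + (4 : ℝ[X]) * a ^ 4 * δ ^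 2 * (X * derivative (X * derivative m)) - (4 : ℝ[X]) * a ^ 4 * δ * (X * derivative m) * (X * derivative δ) - a ^ 3 * m ^ 3 * (X * derivative (X * derivative δ)) - (5 : ℝ[X]) * a ^ 3 * m ^ 2 * δ * (X * derivative (X * derivative m)) + (4 : ℝ[X]) * a ^ 3 * m ^ 2 * (X * derivative m) * (X * derivative δ) - (8 : ℝ[X]) * a ^ 3 * m * δ ^ 2 * (X * derivative (X * derivative a)) + (2 : ℝ[X]) * a ^ 3 * m * δ * (X * derivative a) * (X * derivative δ) + a ^ 3 * m * δ * (X * derivative m) ^ 2 - (4 : ℝ[X]) * a ^ 3 * δ ^ 2 * (X * derivative a) * (X * derivative m) + a ^ 2 * m ^ 4 * (X * derivative (X * derivative m)) + (6 : ℝ[X]) * a ^ 2 * m ^ 3 * δ * (X * derivative (X * derivative a)) - (2 : ℝ[X]) * a ^ 2 * m ^ 3 * (X * derivative a) * (X * derivative δ) - a ^ 2 * m ^ 3 * (X * derivative m) ^ 2 + (4 : ℝ[X]) * a ^ 2 * m ^ 2 * δ * (X * derivative a) * (X * derivative m) + (9 : ℝ[X]) * a ^ 2 * m * δ ^ 2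 * (X * derivative a) ^ 2 - a * m ^ 5 * (X * derivative (X * derivative a)) - (7 : ℝ[X]) * a * m ^ 3 * δ * (X * derivative a) ^ 2 + m ^ 5 * (X * derivative a) ^ 2) ^ 2).support ⊆ 27 • E := by
  have hU := supp_U a m δ E ha hm hδ
  have hV := supp_V a m δ E ha hm hδ
  exact supp_add (supp_sub (supp_cast (supp_mul ha (supp_pow hV 2 (by norm_num))) (by norm_num))
    (supp_cast (supp_mul (supp_mul hm hU) hV) (by norm_num)))
    (supp_cast (supp_mul hδ (supp_pow hU 2 (by norm_num))) (by norm_num))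

/-- `supp (W(f)·a² − W(a)·f²) ⊆ 10 • E` for `supp f ⊆ 3•E`, `supp a ⊆ 2•E` (the rank-one resultant at `(2,1)` with
`a ≡ 0`). [folklore] -/
theorem supp_R10 (f a : ℝ[X]) (E : Finset ℕ) (hf : f.support ⊆ 3 • E) (ha : a.support ⊆ 2 • E) :
    ((f * (X * derivative (X * derivative f)) - (X * derivative f) ^ 2) * a ^ 2 - (a * (X * derivative (X * derivative a)) - (X * derivative a) ^ 2) * f ^ 2).support ⊆ 10 • E := by
  have hf1 := supp_theta hf
  have hf2 := supp_theta hf1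
  have ha1 := supp_theta ha
  have ha2 := supp_theta ha1
  exact supp_sub (supp_cast (supp_mul (supp_sub (supp_mul hf hf2) (supp_cast (supp_pow hf1 2 (by norm_num)) (by norm_num)))
      (supp_pow ha 2 (by norm_num))) (by norm_num))
    (supp_cast (supp_mul (supp_sub (supp_mul ha ha2) (supp_cast (supp_pow ha1 2 (by norm_num)) (by norm_num)))
      (supp_pow hf 2 (by norm_num))) (by norm_num))

/-- Power bookkeeping: `K^i ≤ K^27` for `1 ≤ i ≤ 27`. [folklore] -/
theorem pow_le_pow_27 (K i : ℕ) (h1 : 1 ≤ i) (h27 : i ≤ 27) : K ^ i ≤ K ^ 27 := by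
  rcases Nat.eq_zero_or_pos K with hK | hK
  · subst hK; rw [zero_pow (by omega), zero_pow (by omega)]
  · exact Nat.pow_le_pow_right hK h27

/-! ### The `(2, 1)` splitting -/

-- the proof instantiates `hess_reduce_poly` / `nonmonic_cusp_ncard_le` with the explicit `U`, `V`: slow elaboration.
set_option maxHeartbeats 1600000 in
/-- **The `(2,1)` splitting of `OsculationLawAt 3 K ·`.**  For every `K`, every exponent vector `d` and every symmetric
block pencil `S : Fin K → Matrix (Fin 2 ⊕ Fin 1) (Fin 2 ⊕ Fin 1) ℝ`: if the osculation set of the spectral curve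
`det(Σ_l t^(d l) S_l + b·(I₂ ⊕ 0)) = 0` (the line's `osculationSet d S`, UNFOLDED verbatim) is finite, it has at most
`5 · K²⁷` points. -/
theorem osc_two_one (K : ℕ) (d : Fin K → ℕ) (S : Fin K → Matrix (Fin 2 ⊕ Fin 1) (Fin 2 ⊕ Fin 1) ℝ)
    (hS : ∀ l, (S l).IsSymm) (hfin : {p : Fin 2 → ℝ | 0 < p 0 ∧ 0 < p 1 ∧ MvPolynomial.eval p (∑ l, (MvPolynomial.X (0 : Fin 2) : MvPolynomial (Fin 2) ℝ) ^ d l •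
              (S l).map (MvPolynomial.C : ℝ →+* MvPolynomial (Fin 2) ℝ)
            + (MvPolynomial.X (1 : Fin 2) : MvPolynomial (Fin 2) ℝ) •
              (Matrix.fromBlocks 1 0 0 0 : Matrix (Fin 2 ⊕ Fin 1) (Fin 2 ⊕ Fin 1) ℝ).map
                (MvPolynomial.C : ℝ →+* MvPolynomial (Fin 2) ℝ)).det = 0 ∧
      MvPolynomial.eval p
        (MvPolynomial.X 0 * MvPolynomial.pderiv 0 (MvPolynomial.X 0 * MvPolynomial.pderiv 0 (∑ l, (MvPolynomial.X (0 : Fin 2) : MvPolynomial (Fin 2) ℝ) ^ d l •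
              (S l).map (MvPolynomial.C : ℝ →+* MvPolynomial (Fin 2) ℝ)
            + (MvPolynomial.X (1 : Fin 2) : MvPolynomial (Fin 2) ℝ) •
              (Matrix.fromBlocks 1 0 0 0 : Matrix (Fin 2 ⊕ Fin 1) (Fin 2 ⊕ Fin 1) ℝ).map
                (MvPolynomial.C : ℝ →+* MvPolynomial (Fin 2) ℝ)).det)
            * (MvPolynomial.X 1 * MvPolynomial.pderiv 1 (∑ l, (MvPolynomial.X (0 : Fin 2) : MvPolynomial (Fin 2) ℝ) ^ d l •
              (S l).map (MvPolynomial.C : ℝ →+* MvPolynomial (Fin 2) ℝ)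
            + (MvPolynomial.X (1 : Fin 2) : MvPolynomial (Fin 2) ℝ) •
              (Matrix.fromBlocks 1 0 0 0 : Matrix (Fin 2 ⊕ Fin 1) (Fin 2 ⊕ Fin 1) ℝ).map
                (MvPolynomial.C : ℝ →+* MvPolynomial (Fin 2) ℝ)).det) ^ 2
          - 2 * (MvPolynomial.X 0 * MvPolynomial.pderiv 0 (MvPolynomial.X 1 * MvPolynomial.pderiv 1 (∑ l, (MvPolynomial.X (0 : Fin 2) : MvPolynomial (Fin 2) ℝ) ^ d l •
              (S l).map (MvPolynomial.C : ℝ →+* MvPolynomial (Fin 2) ℝ)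
            + (MvPolynomial.X (1 : Fin 2) : MvPolynomial (Fin 2) ℝ) •
              (Matrix.fromBlocks 1 0 0 0 : Matrix (Fin 2 ⊕ Fin 1) (Fin 2 ⊕ Fin 1) ℝ).map
                (MvPolynomial.C : ℝ →+* MvPolynomial (Fin 2) ℝ)).det))
            * (MvPolynomial.X 0 * MvPolynomial.pderiv 0 (∑ l, (MvPolynomial.X (0 : Fin 2) : MvPolynomial (Fin 2) ℝ) ^ d l •
              (S l).map (MvPolynomial.C : ℝ →+* MvPolynomial (Fin 2) ℝ)
            + (MvPolynomial.X (1 : Fin 2) : MvPolynomial (Fin 2) ℝ) •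
              (Matrix.fromBlocks 1 0 0 0 : Matrix (Fin 2 ⊕ Fin 1) (Fin 2 ⊕ Fin 1) ℝ).map
                (MvPolynomial.C : ℝ →+* MvPolynomial (Fin 2) ℝ)).det) * (MvPolynomial.X 1 * MvPolynomial.pderiv 1 (∑ l, (MvPolynomial.X (0 : Fin 2) : MvPolynomial (Fin 2) ℝ) ^ d l •
              (S l).map (MvPolynomial.C : ℝ →+* MvPolynomial (Fin 2) ℝ)
            + (MvPolynomial.X (1 : Fin 2) : MvPolynomial (Fin 2) ℝ) •
              (Matrix.fromBlocks 1 0 0 0 : Matrix (Fin 2 ⊕ Fin 1) (Fin 2 ⊕ Fin 1) ℝ).map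
                (MvPolynomial.C : ℝ →+* MvPolynomial (Fin 2) ℝ)).det)
          + MvPolynomial.X 1 * MvPolynomial.pderiv 1 (MvPolynomial.X 1 * MvPolynomial.pderiv 1 (∑ l, (MvPolynomial.X (0 : Fin 2) : MvPolynomial (Fin 2) ℝ) ^ d l •
              (S l).map (MvPolynomial.C : ℝ →+* MvPolynomial (Fin 2) ℝ)
            + (MvPolynomial.X (1 : Fin 2) : MvPolynomial (Fin 2) ℝ) •
              (Matrix.fromBlocks 1 0 0 0 : Matrix (Fin 2 ⊕ Fin 1) (Fin 2 ⊕ Fin 1) ℝ).map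
                (MvPolynomial.C : ℝ →+* MvPolynomial (Fin 2) ℝ)).det)
            * (MvPolynomial.X 0 * MvPolynomial.pderiv 0 (∑ l, (MvPolynomial.X (0 : Fin 2) : MvPolynomial (Fin 2) ℝ) ^ d l •
              (S l).map (MvPolynomial.C : ℝ →+* MvPolynomial (Fin 2) ℝ)
            + (MvPolynomial.X (1 : Fin 2) : MvPolynomial (Fin 2) ℝ) •
              (Matrix.fromBlocks 1 0 0 0 : Matrix (Fin 2 ⊕ Fin 1) (Fin 2 ⊕ Fin 1) ℝ).map
                (MvPolynomial.C : ℝ →+* MvPolynomial (Fin 2) ℝ)).det) ^ 2) = 0}.Finite) :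
    {p : Fin 2 → ℝ | 0 < p 0 ∧ 0 < p 1 ∧ MvPolynomial.eval p (∑ l, (MvPolynomial.X (0 : Fin 2) : MvPolynomial (Fin 2) ℝ) ^ d l •
              (S l).map (MvPolynomial.C : ℝ →+* MvPolynomial (Fin 2) ℝ)
            + (MvPolynomial.X (1 : Fin 2) : MvPolynomial (Fin 2) ℝ) •
              (Matrix.fromBlocks 1 0 0 0 : Matrix (Fin 2 ⊕ Fin 1) (Fin 2 ⊕ Fin 1) ℝ).map
                (MvPolynomial.C : ℝ →+* MvPolynomial (Fin 2) ℝ)).det = 0 ∧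
      MvPolynomial.eval p
        (MvPolynomial.X 0 * MvPolynomial.pderiv 0 (MvPolynomial.X 0 * MvPolynomial.pderiv 0 (∑ l, (MvPolynomial.X (0 : Fin 2) : MvPolynomial (Fin 2) ℝ) ^ d l •
              (S l).map (MvPolynomial.C : ℝ →+* MvPolynomial (Fin 2) ℝ)
            + (MvPolynomial.X (1 : Fin 2) : MvPolynomial (Fin 2) ℝ) •
              (Matrix.fromBlocks 1 0 0 0 : Matrix (Fin 2 ⊕ Fin 1) (Fin 2 ⊕ Fin 1) ℝ).map
                (MvPolynomial.C : ℝ →+* MvPolynomial (Fin 2) ℝ)).det)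
            * (MvPolynomial.X 1 * MvPolynomial.pderiv 1 (∑ l, (MvPolynomial.X (0 : Fin 2) : MvPolynomial (Fin 2) ℝ) ^ d l •
              (S l).map (MvPolynomial.C : ℝ →+* MvPolynomial (Fin 2) ℝ)
            + (MvPolynomial.X (1 : Fin 2) : MvPolynomial (Fin 2) ℝ) •
              (Matrix.fromBlocks 1 0 0 0 : Matrix (Fin 2 ⊕ Fin 1) (Fin 2 ⊕ Fin 1) ℝ).map
                (MvPolynomial.C : ℝ →+* MvPolynomial (Fin 2) ℝ)).det) ^ 2
          - 2 * (MvPolynomial.X 0 * MvPolynomial.pderiv 0 (MvPolynomial.X 1 * MvPolynomial.pderiv 1 (∑ l, (MvPolynomial.X (0 : Fin 2) : MvPolynomial (Fin 2) ℝ) ^ d l •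
              (S l).map (MvPolynomial.C : ℝ →+* MvPolynomial (Fin 2) ℝ)
            + (MvPolynomial.X (1 : Fin 2) : MvPolynomial (Fin 2) ℝ) •
              (Matrix.fromBlocks 1 0 0 0 : Matrix (Fin 2 ⊕ Fin 1) (Fin 2 ⊕ Fin 1) ℝ).map
                (MvPolynomial.C : ℝ →+* MvPolynomial (Fin 2) ℝ)).det))
            * (MvPolynomial.X 0 * MvPolynomial.pderiv 0 (∑ l, (MvPolynomial.X (0 : Fin 2) : MvPolynomial (Fin 2) ℝ) ^ d l •
              (S l).map (MvPolynomial.C : ℝ →+* MvPolynomial (Fin 2) ℝ)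
            + (MvPolynomial.X (1 : Fin 2) : MvPolynomial (Fin 2) ℝ) •
              (Matrix.fromBlocks 1 0 0 0 : Matrix (Fin 2 ⊕ Fin 1) (Fin 2 ⊕ Fin 1) ℝ).map
                (MvPolynomial.C : ℝ →+* MvPolynomial (Fin 2) ℝ)).det) * (MvPolynomial.X 1 * MvPolynomial.pderiv 1 (∑ l, (MvPolynomial.X (0 : Fin 2) : MvPolynomial (Fin 2) ℝ) ^ d l •
              (S l).map (MvPolynomial.C : ℝ →+* MvPolynomial (Fin 2) ℝ)
            + (MvPolynomial.X (1 : Fin 2) : MvPolynomial (Fin 2) ℝ) •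
              (Matrix.fromBlocks 1 0 0 0 : Matrix (Fin 2 ⊕ Fin 1) (Fin 2 ⊕ Fin 1) ℝ).map
                (MvPolynomial.C : ℝ →+* MvPolynomial (Fin 2) ℝ)).det)
          + MvPolynomial.X 1 * MvPolynomial.pderiv 1 (MvPolynomial.X 1 * MvPolynomial.pderiv 1 (∑ l, (MvPolynomial.X (0 : Fin 2) : MvPolynomial (Fin 2) ℝ) ^ d l •
              (S l).map (MvPolynomial.C : ℝ →+* MvPolynomial (Fin 2) ℝ)
            + (MvPolynomial.X (1 : Fin 2) : MvPolynomial (Fin 2) ℝ) •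
              (Matrix.fromBlocks 1 0 0 0 : Matrix (Fin 2 ⊕ Fin 1) (Fin 2 ⊕ Fin 1) ℝ).map
                (MvPolynomial.C : ℝ →+* MvPolynomial (Fin 2) ℝ)).det)
            * (MvPolynomial.X 0 * MvPolynomial.pderiv 0 (∑ l, (MvPolynomial.X (0 : Fin 2) : MvPolynomial (Fin 2) ℝ) ^ d l •
              (S l).map (MvPolynomial.C : ℝ →+* MvPolynomial (Fin 2) ℝ)
            + (MvPolynomial.X (1 : Fin 2) : MvPolynomial (Fin 2) ℝ) •
              (Matrix.fromBlocks 1 0 0 0 : Matrix (Fin 2 ⊕ Fin 1) (Fin 2 ⊕ Fin 1) ℝ).map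
                (MvPolynomial.C : ℝ →+* MvPolynomial (Fin 2) ℝ)).det) ^ 2) = 0}.ncard ≤ 5 * K ^ 27 := by

  classical
  have hEK : (Finset.univ.image d).card ≤ K := (Finset.card_image_le).trans (by simp)
  have hΦ := insertionPoly_two_one K d S
  have ha : ((∑ l, (X : ℝ[X]) ^ d l • (S l).map Polynomial.C) (Sum.inr 0) (Sum.inr 0)).support ⊆ 1 • Finset.univ.image d := support_pencil_apply d S _ _
  have hm := supp_m K d S
  have hδ : ((∑ l, (X : ℝ[X]) ^ d l • (S l).map Polynomial.C).det).support ⊆ 3 • Finset.univ.image d :=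
    supp_cast (supp_det_pencil d S) (by simp [Fintype.card_sum, Fintype.card_fin])
  have h10 : K ^ 10 ≤ 5 * K ^ 27 := by have := pow_le_pow_27 K 10 (by norm_num) (by norm_num); omega
  have h27 : K ^ 27 + 2 * K ^ 12 + 2 * K ^ 13 ≤ 5 * K ^ 27 := by
    have := pow_le_pow_27 K 12 (by norm_num) (by norm_num); have := pow_le_pow_27 K 13 (by norm_num) (by norm_num); omega
  by_cases ha0 : (∑ l, (X : ℝ[X]) ^ d l • (S l).map Polynomial.C) (Sum.inr 0) (Sum.inr 0) = 0
  · -- rank-one shape `Φ = ι δ + X₁·ι m`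
    have hΦ' : (∑ l, (MvPolynomial.X (0 : Fin 2) : MvPolynomial (Fin 2) ℝ) ^ d l •
              (S l).map (MvPolynomial.C : ℝ →+* MvPolynomial (Fin 2) ℝ)
            + (MvPolynomial.X (1 : Fin 2) : MvPolynomial (Fin 2) ℝ) •
              (Matrix.fromBlocks 1 0 0 0 : Matrix (Fin 2 ⊕ Fin 1) (Fin 2 ⊕ Fin 1) ℝ).map
                (MvPolynomial.C : ℝ →+* MvPolynomial (Fin 2) ℝ)).det =
        Polynomial.aeval (MvPolynomial.X 0 : MvPolynomial (Fin 2) ℝ) (∑ l, (X : ℝ[X]) ^ d l • (S l).map Polynomial.C).det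
          + MvPolynomial.X 1 * Polynomial.aeval (MvPolynomial.X 0 : MvPolynomial (Fin 2) ℝ) ((∑ l, (X : ℝ[X]) ^ d l • (S l).map Polynomial.C) (Sum.inl 0) (Sum.inl 0) * (∑ l, (X : ℝ[X]) ^ d l • (S l).map Polynomial.C) (Sum.inr 0) (Sum.inr 0) - (∑ l, (X : ℝ[X]) ^ d l • (S l).map Polynomial.C) (Sum.inl 0) (Sum.inr 0) * (∑ l, (X : ℝ[X]) ^ d l • (S l).map Polynomial.C) (Sum.inr 0) (Sum.inl 0) + (∑ l, (X : ℝ[X]) ^ d l • (S l).map Polynomial.C) (Sum.inl 1) (Sum.inl 1) * (∑ l, (X : ℝ[X]) ^ d l • (S l).map Polynomial.C) (Sum.inr 0) (Sum.inr 0) - (∑ l, (X : ℝ[X]) ^ d l • (S l).map Polynomial.C) (Sum.inl 1) (Sum.inr 0) * (∑ l, (X : ℝ[X]) ^ d l • (S l).map Polynomial.C) (Sum.inr 0) (Sum.inl 1)) := by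
      rw [hΦ, ha0, map_zero, mul_zero, zero_add, add_comm]
    refine (OsculationRankOne.osc_ncard_le _ _ _ hΦ' hfin).trans ?_
    refine (OsculationRankOne.card_roots_filter_pos_le_card_support _).trans ?_
    exact ((card_support_le_of_subset_nsmul (supp_R10 _ _ _ hδ hm)).trans (Nat.pow_le_pow_left hEK 10)).trans h10
  · have hcount := OsculationCuspGen.nonmonic_cusp_ncard_le _ _ _ _ _ _ hΦ ha0 (disc_two_one K d S hS)
      (fun t b hΨ => OsculationCuspGen.hess_reduce_poly _ _ _ _ _ t b _ _ _ _ _ _ _ _ _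
        rfl rfl rfl rfl rfl rfl rfl rfl rfl rfl rfl hΨ) hfin
    have hN := (card_support_le_of_subset_nsmul (supp_N _ _ _ _ ha hm hδ)).trans (Nat.pow_le_pow_left hEK 27)
    have hU := (card_support_le_of_subset_nsmul (supp_U _ _ _ _ ha hm hδ)).trans (Nat.pow_le_pow_left hEK 12)
    have hV := (card_support_le_of_subset_nsmul (supp_V _ _ _ _ ha hm hδ)).trans (Nat.pow_le_pow_left hEK 13)
    exact hcount.trans ((Nat.add_le_add (Nat.add_le_add hN (Nat.mul_le_mul_left 2 hU))
      (Nat.mul_le_mul_left 2 hV)).trans h27)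

end OsculationThreeK

end Summit.ValiantsHypothesis.ValiantsHypothesis.Theorems.LacunarySymmetroidMatrixDescartes
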